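import Summits.BirchSwinnertonDyer.BirchSwinnertonDyer.Theorems.ClassRecordThreeCartanSupplySphericalLeaves
import HarnessLib

/-!
# Frobenius pairing pins the cubic principal series — §F.1–§F.5 of the `doublecoset` certificate for crux 24801 `CartanOnePlaceDegreeLawAtThree`

Lift-only port (cell bsd-stepL, SUMMON key `k5-lift1`, director-bsd (734)(1) CONCUR 2026-08-31) of §F.1–§F.5 (source lines 958–1304) of the crux-ideate workfile
`Summits/BirchSwinnertonDyer/BirchSwinnertonDyer/Cruxes/CartanOnePlaceDegreeLawAtThree/Lines/doublecoset.lean` (lineage `cruxidea-stmt-BirchSwinnertonDyer-24801-1`, generation 22,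
commit 721e9ccbdf4b, sha256-16 d3adee7328f6a76c, 2876 l.; farm rc 0, sorries 4 = its §4 stubs, none of which is lifted; referee landing record `VERDICT-DOUBLECOSET-G22-g88.md`).
Declarations, statements and proofs below are BYTE-IDENTICAL to the source; the only edits are the namespace (`…Cruxes.CartanOnePlaceDegreeLawAtThree.Doublecoset` ↦
`…Theorems.CartanDoubleCoset`, shared by the nine `ClassRecordThreeCartanSupply*` modules), the imports ∕ `open`s each module needs, and one-line docstrings added where the source
had none. Nothing is re-stated, weakened or re-proved.

CONTENT (finite group theory; generation 20, real proofs). §F.1 the line `lineRep θ` of a character, restriction `res`, eigenvectors as intertwiners (`smulVec`,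
`finrank_hom_pos`, `finrank_hom_eq_zero`). §F.2 Schur: a non-zero intertwiner out of an irreducible into a representation with no proper stable subspace forces equal
characters (`char_eq_of_finrank_hom_ne_zero`). §F.3 FROBENIUS PAIRING against the tree's monomial representations `CartanSupply.Monomial.monRep`
(`frobenius_pairing`, `frobenius_reciprocity`: `Σ_g χ_σ(g) χ_{Ind_H θ}(g⁻¹) = |Γ|·dim Hom_H(θ, Res σ)`; the pinning principle `char_eq_of_pairing_ne_zero`). §F.4 the
irreducible realisation of `cubicNewvectorChar q` from the tree's virtual engine (`exists_irreducible_of_realisation`, `exists_irreducible_cubic`). §F.5 (FGT-PS)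
`CubicPrincipalSeriesCharacter` PROVED (`lam_eq_borelChar`, `cubicPrincipalSeriesCharacter`).

HONEST: a `--supports stmt-BirchSwinnertonDyer-24801` helper module; it proves NOTHING about NUM ∕ NUM♮ (items 24801 ∕ 32276) or crux 19109 for any curve — the leaves (MO1)
`SplitLevelMultiplicityOne`, (BCV) `BorelCubicEigenDocking`, (VAN) `NonsplitTorusCubicVanishing`, (DS) ∧ (JLᶜ) stay OPEN; registry `Lines/petarea.lean` rev 8 untouched; BSD is proved for no curve.
-/

set_option linter.dupNamespace false  -- `Summit.BirchSwinnertonDyer.BirchSwinnertonDyer.…` (summit = problem), as every file of this directory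
set_option autoImplicit false

noncomputable section

open scoped Classical MatrixGroups
open Matrix

namespace Summit.BirchSwinnertonDyer.BirchSwinnertonDyer.Theorems.CartanDoubleCoset

open Summit.BirchSwinnertonDyer.BirchSwinnertonDyer.Theorems
open Summit.BirchSwinnertonDyer.BirchSwinnertonDyer.Theorems.CartanDegree (HasRatEigenvalue)
open Summit.BirchSwinnertonDyer.BirchSwinnertonDyer.Theorems.CartanTorusCubeCut (torusSubgroup mem_torusSubgroup lin linGL linGL_coe lin_comm torusSubgroup_isCyclic card_torusSubgroup)
open Summit.BirchSwinnertonDyer.BirchSwinnertonDyer.Theorems.CartanCover (splitGen mem_splitTorus_iff)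
open Summit.BirchSwinnertonDyer.BirchSwinnertonDyer.Theorems.CartanCover.Charext.InertHecke (upperUnip lowerUnip coe_upperUnip coe_lowerUnip upperUnip_mul upperUnip_zero exists_unip_factorization)
open Summit.BirchSwinnertonDyer.BirchSwinnertonDyer.Theorems.CartanDegree (cubicNewvectorChar HasRatEigenvalue)

/-! ## §F (generation 20 — NEW, sorry-free): FROBENIUS PAIRING PINS THE CUBIC CHARACTERS

The lever: for a subgroup `H ≤ Γ`, a character `θ : H → k×` and any representation `σ` of `Γ`,
`Σ_g χ_σ(g) · χ_{Ind_H^Γ θ}(g⁻¹) = |Γ| · dim Hom_H(θ, Res σ)` (`frobenius_reciprocity`, from the tree's monomial character formula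
`card_mul_character` and Schur orthogonality `sum_char_mul_char_inv`). Paired against the tree's REALISATIONS of `cubicNewvectorChar q`
(`psChar_eq`: `χ = χ_{Ind_B^G(χ₃ ⊠ χ₃⁻¹)}` at `q ≡ 1 (3)`; `cuspChar_eq`: `χ = χ_{Ind_{ZN} ψ} − χ_{Ind_{T_η} θ₃}` at `q ≡ 2 (3)`, `q ≥ 5`;
`χ = χ_{Ind_{T_η} 1} − 1` at `q = 2`, proved here) an eigenvector hypothesis becomes `dim Hom_G(U, W) ≠ 0` for the irreducible `U` with
`χ_U = cubicNewvectorChar q` (`exists_irreducible_of_virtual_normOne`), and Schur's lemma makes `W ≅ U`: (FGT-PS) and (FGT-C) are THEOREMS. -/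

section LineRep

open Representation (IntertwiningMap)

variable {Γ : Type*} [Group Γ] {k : Type*} [Field k]

/-! ### §F.1 The line of a character, restriction, eigenvectors as intertwiners -/

/-- the one-dimensional representation `h ↦ θ(h)` of `Γ` on `k`. -/
def lineRep (θ : Γ →* k) : Representation k Γ k where
  toFun h := θ h • LinearMap.id
  map_one' := by rw [map_one, one_smul]; rfl
  map_mul' a b := by
    apply LinearMap.ext
    intro c
    simp only [map_mul, LinearMap.smul_apply, LinearMap.id_coe, id_eq, smul_eq_mul, Module.End.mul_apply]
    ring

/-- `lineRep θ h c = θ h * c`. -/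
theorem lineRep_apply (θ : Γ →* k) (h : Γ) (c : k) : lineRep θ h c = θ h * c := rfl

/-- the character of `lineRep θ` is `θ`. -/
theorem lineRep_character (θ : Γ →* k) (h : Γ) : (lineRep θ).character h = θ h := by
  show LinearMap.trace k k (θ h • LinearMap.id) = θ h
  rw [map_smul, LinearMap.trace_id, Module.finrank_self, Nat.cast_one, smul_eq_mul, mul_one]

variable {V : Type*} [AddCommGroup V] [Module k V]

/-- restriction of a representation to a subgroup. -/
def res (σ : Representation k Γ V) (H : Subgroup Γ) : Representation k H V := σ.comp H.subtype

/-- restriction does not change the action. -/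
theorem res_apply (σ : Representation k Γ V) (H : Subgroup Γ) (h : H) : res σ H h = σ h := rfl

/-- restriction does not change the character. -/
theorem res_character (σ : Representation k Γ V) (H : Subgroup Γ) (h : H) : (res σ H).character h = σ.character h := rfl

/-- the image of `1` under an intertwiner `lineRep θ → σ` is a `θ`-eigenvector. -/
theorem eigen_of_intertwining (θ : Γ →* k) (σ : Representation k Γ V) (φ : IntertwiningMap (lineRep θ) σ) (h : Γ) :
    σ h (φ 1) = θ h • φ 1 := by
  have h1 := IntertwiningMap.isIntertwining _ _ φ h 1
  rw [lineRep_apply, mul_one] at h1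
  have h2 : φ (θ h • (1 : k)) = θ h • φ 1 := map_smul φ _ _
  rw [smul_eq_mul, mul_one] at h2
  rw [← h1, h2]

/-- an intertwiner `lineRep θ → σ` killing `1` is zero. -/
theorem intertwining_eq_zero_of (θ : Γ →* k) (σ : Representation k Γ V) (φ : IntertwiningMap (lineRep θ) σ) (h0 : φ 1 = 0) :
    φ = 0 :=
  IntertwiningMap.ext (LinearMap.ext_ring (by rw [IntertwiningMap.toLinearMap_apply, h0, IntertwiningMap.zero_toLinearMap, LinearMap.zero_apply]))

/-- a `θ`-eigenvector `v` gives the intertwiner `c ↦ c • v : lineRep θ → σ`. -/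
def smulVec (θ : Γ →* k) (σ : Representation k Γ V) (v : V) (hv : ∀ h : Γ, σ h v = θ h • v) : IntertwiningMap (lineRep θ) σ :=
  (LinearMap.toSpanSingleton k V v).intertwiningMap_of_isIntertwiningMap (lineRep θ) σ fun h c => by
    rw [LinearMap.toSpanSingleton_apply, LinearMap.toSpanSingleton_apply, lineRep_apply, map_smul, hv, smul_smul, mul_comm]

/-- `smulVec θ σ v hv c = c • v`. -/
theorem smulVec_apply (θ : Γ →* k) (σ : Representation k Γ V) (v : V) (hv : ∀ h : Γ, σ h v = θ h • v) (c : k) :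
    smulVec θ σ v hv c = c • v := rfl

variable [FiniteDimensional k V]

/-- a non-zero `θ`-eigenvector makes `Hom_Γ(θ, σ)` non-zero. -/
theorem finrank_hom_pos (θ : Γ →* k) (σ : Representation k Γ V) {v : V} (hv0 : v ≠ 0) (hv : ∀ h : Γ, σ h v = θ h • v) :
    0 < Module.finrank k (IntertwiningMap (lineRep θ) σ) := by
  refine Module.finrank_pos_iff_exists_ne_zero.2 ⟨smulVec θ σ v hv, fun h0 => hv0 ?_⟩
  have := congrArg (fun φ : IntertwiningMap (lineRep θ) σ => φ 1) h0
  simpa [smulVec_apply] using this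

omit [FiniteDimensional k V] in
/-- no non-zero `θ`-eigenvector makes `Hom_Γ(θ, σ)` zero. -/
theorem finrank_hom_eq_zero (θ : Γ →* k) (σ : Representation k Γ V) (hno : ∀ v : V, (∀ h : Γ, σ h v = θ h • v) → v = 0) :
    Module.finrank k (IntertwiningMap (lineRep θ) σ) = 0 := by
  haveI : Subsingleton (IntertwiningMap (lineRep θ) σ) := ⟨fun φ ψ => by
    rw [intertwining_eq_zero_of θ σ φ (hno _ (eigen_of_intertwining θ σ φ)),
      intertwining_eq_zero_of θ σ ψ (hno _ (eigen_of_intertwining θ σ ψ))]⟩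
  exact Module.finrank_zero_of_subsingleton

/-! ### §F.2 Schur: a non-zero intertwiner out of an irreducible into an irreducible is an isomorphism — equal characters -/

omit [FiniteDimensional k V] in
/-- **Schur.** `dim Hom_Γ(U, W) ≠ 0`, `U` irreducible, `W` with no proper non-zero stable subspace ⟹ `χ_W = χ_U`. -/
theorem char_eq_of_finrank_hom_ne_zero {U : Type*} [AddCommGroup U] [Module k U] [FiniteDimensional k U] [FiniteDimensional k V]
    (ρU : Representation k Γ U) (ρW : Representation k Γ V) (hU : ρU.IsIrreducible)
    (hW : ∀ W' : Submodule k V, (∀ g : Γ, ∀ w ∈ W', ρW g w ∈ W') → W' = ⊥ ∨ W' = ⊤)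
    (h : Module.finrank k (IntertwiningMap ρU ρW) ≠ 0) : ∀ g : Γ, ρW.character g = ρU.character g := by
  haveI := hU
  obtain ⟨φ, hφ⟩ := Module.finrank_pos_iff_exists_ne_zero.1 (Nat.pos_of_ne_zero h)
  have hinj : Function.Injective φ.toLinearMap := by
    rcases Representation.IsIrreducible.injective_or_eq_zero φ with hi | h0
    · exact hi
    · exact absurd h0 hφ
  have hst : ∀ g : Γ, ∀ w ∈ LinearMap.range φ.toLinearMap, ρW g w ∈ LinearMap.range φ.toLinearMap := by
    rintro g _ ⟨x, rfl⟩
    exact ⟨ρU g x, IntertwiningMap.isIntertwining _ _ φ g x⟩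
  have htop : LinearMap.range φ.toLinearMap = ⊤ :=
    (hW _ hst).resolve_left fun hbot => hφ (IntertwiningMap.ext (by rw [IntertwiningMap.zero_toLinearMap]; exact LinearMap.range_eq_bot.1 hbot))
  have hsurj : Function.Surjective φ.toLinearMap := LinearMap.range_eq_top.1 htop
  let e : U ≃ₗ[k] V := LinearEquiv.ofBijective φ.toLinearMap ⟨hinj, hsurj⟩
  intro g
  have hconj : ρW g = e.conj (ρU g) := by
    apply LinearMap.ext
    intro w
    rw [LinearEquiv.conj_apply_apply]
    obtain ⟨x, rfl⟩ := hsurj w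
    have hx : e x = φ.toLinearMap x := rfl
    rw [← hx, e.symm_apply_apply, hx]
    exact (IntertwiningMap.isIntertwining _ _ φ g x).symm
  show LinearMap.trace k V (ρW g) = LinearMap.trace k U (ρU g)
  rw [hconj, LinearMap.trace_conj']

end LineRep

section Pairing

open Representation (IntertwiningMap)
open Summit.BirchSwinnertonDyer.BirchSwinnertonDyer.Theorems.CartanSupply.Monomial (monRep wt wt_of_mem wt_of_not_mem card_mul_character)
open Summit.BirchSwinnertonDyer.BirchSwinnertonDyer.Theorems.CartanSupply.VirtualCharacter (sum_char_mul_char_inv)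

variable {Γ : Type*} [Group Γ] [Fintype Γ] (H : Subgroup Γ) {k : Type*} [Field k] (θ : H →* k)
variable {V : Type*} [AddCommGroup V] [Module k V]

/-! ### §F.3 Frobenius pairing against a monomial representation -/

/-- `Σ_g f(g)·wt(g⁻¹) = Σ_{h ∈ H} f(h)·θ(h⁻¹)` — the weight vanishes off `H`. -/
theorem sum_mul_wt_inv (f : Γ → k) : ∑ g : Γ, f g * wt H θ g⁻¹ = ∑ h : H, f h * θ h⁻¹ := by
  rw [← Fintype.sum_subtype_add_sum_subtype (fun g : Γ => g ∈ H) (fun g : Γ => f g * wt H θ g⁻¹)]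
  have h0 : ∑ a : {a : Γ // ¬ a ∈ H}, f a * wt H θ (a : Γ)⁻¹ = 0 :=
    Finset.sum_eq_zero fun a _ => by
      rw [wt_of_not_mem H θ (fun h' => a.2 ((Subgroup.inv_mem_iff H).1 h')), mul_zero]
  rw [h0, add_zero]
  refine Fintype.sum_equiv (Equiv.refl _) _ _ fun h => ?_
  rw [Equiv.refl_apply, wt_of_mem H θ (H.inv_mem h.2)]
  rfl

/-- **FROBENIUS PAIRING.** `|H| · Σ_g χ_σ(g) χ_{Ind_H^Γ θ}(g⁻¹) = |Γ| · Σ_{h ∈ H} χ_σ(h) θ(h⁻¹)`. -/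
theorem frobenius_pairing (σ : Representation k Γ V) :
    (Nat.card H : k) * ∑ g : Γ, σ.character g * (monRep H θ).character g⁻¹ =
      (Fintype.card Γ : k) * ∑ h : H, σ.character h * θ h⁻¹ := by
  calc (Nat.card H : k) * ∑ g : Γ, σ.character g * (monRep H θ).character g⁻¹
      = ∑ g : Γ, σ.character g * ((Nat.card H : k) * (monRep H θ).character g⁻¹) := by
        rw [Finset.mul_sum]
        exact Finset.sum_congr rfl fun g _ => by ring
    _ = ∑ g : Γ, ∑ x : Γ, σ.character g * wt H θ (x⁻¹ * g⁻¹ * x) := by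
        refine Finset.sum_congr rfl fun g _ => ?_
        rw [card_mul_character, Finset.mul_sum]
    _ = ∑ x : Γ, ∑ g : Γ, σ.character g * wt H θ (x⁻¹ * g⁻¹ * x) := Finset.sum_comm
    _ = ∑ x : Γ, ∑ g : Γ, σ.character g * wt H θ g⁻¹ := by
        refine Finset.sum_congr rfl fun x _ => ?_
        refine Fintype.sum_equiv ((Equiv.mulLeft x⁻¹).trans (Equiv.mulRight x)) _ _ fun a => ?_
        simp only [Equiv.trans_apply, Equiv.coe_mulLeft, Equiv.coe_mulRight]
        rw [show (x⁻¹ * a * x)⁻¹ = x⁻¹ * a⁻¹ * x by group,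
          show σ.character (x⁻¹ * a * x) = σ.character a by
            rw [show x⁻¹ * a * x = x⁻¹ * a * x⁻¹⁻¹ by rw [inv_inv], Representation.char_conj]]
    _ = (Fintype.card Γ : k) * ∑ h : H, σ.character h * θ h⁻¹ := by
        rw [Finset.sum_const, Finset.card_univ, nsmul_eq_mul, sum_mul_wt_inv]

variable [FiniteDimensional k V] [CharZero k]

/-- the pairing over `H` is `|H| · dim Hom_H(θ, Res σ)` (Schur orthogonality on `H`). -/
theorem sum_sub_character_mul (σ : Representation k Γ V) :
    ∑ h : H, σ.character h * θ h⁻¹ = (Fintype.card H : k) * Module.finrank k (IntertwiningMap (lineRep θ) (res σ H)) := by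
  rw [← sum_char_mul_char_inv (lineRep θ) (res σ H)]
  exact Fintype.sum_congr _ _ fun h => by rw [res_character, lineRep_character]

/-- **FROBENIUS RECIPROCITY (numerical form).** `Σ_g χ_σ(g) · χ_{Ind_H^Γ θ}(g⁻¹) = |Γ| · dim Hom_H(θ, Res_H σ)`. -/
theorem frobenius_reciprocity (σ : Representation k Γ V) :
    ∑ g : Γ, σ.character g * (monRep H θ).character g⁻¹ =
      (Fintype.card Γ : k) * Module.finrank k (IntertwiningMap (lineRep θ) (res σ H)) := by
  have h := frobenius_pairing H θ σ
  rw [sum_sub_character_mul, ← Nat.card_eq_fintype_card (α := H)] at h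
  have hH : (Nat.card H : k) ≠ 0 := by
    rw [Nat.card_eq_fintype_card]; exact_mod_cast Fintype.card_ne_zero
  apply mul_left_cancel₀ hH
  rw [h]; ring

/-- **the pinning principle**: a non-zero pairing of `χ_W` against the character of an irreducible `U` forces `χ_W = χ_U`. -/
theorem char_eq_of_pairing_ne_zero {U : Type*} [AddCommGroup U] [Module k U] [FiniteDimensional k U]
    (ρU : Representation k Γ U) (ρW : Representation k Γ V) (hU : ρU.IsIrreducible)
    (hW : ∀ W' : Submodule k V, (∀ g : Γ, ∀ w ∈ W', ρW g w ∈ W') → W' = ⊥ ∨ W' = ⊤)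
    (hpair : ∑ g : Γ, ρW.character g * ρU.character g⁻¹ ≠ 0) : ∀ g : Γ, ρW.character g = ρU.character g := by
  refine char_eq_of_finrank_hom_ne_zero ρU ρW hU hW fun h0 => hpair ?_
  rw [sum_char_mul_char_inv ρU ρW, h0, Nat.cast_zero, mul_zero]

end Pairing

/-! ### §F.4 The irreducible realisation of `cubicNewvectorChar q` (the tree's virtual engine) -/

section Realisation

open Representation (IntertwiningMap)
open Summit.BirchSwinnertonDyer.BirchSwinnertonDyer.Theorems.CartanTorusCubeCut (G Mat)
open Summit.BirchSwinnertonDyer.BirchSwinnertonDyer.Theorems.CartanSupply (char_inv char_one_pos)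
open Summit.BirchSwinnertonDyer.BirchSwinnertonDyer.Theorems.CartanSupply.VirtualCharacter (exists_irreducible_of_virtual_normOne
  sum_char_mul_char_inv)
open Summit.BirchSwinnertonDyer.BirchSwinnertonDyer.Theorems.CartanSupply.Monomial

variable {q : ℕ} [Fact q.Prime]

/-- a realisation `χ = χ_A − χ_B` with `Σ χ² = |G|` yields an irreducible `U` with `χ_U = cubicNewvectorChar q`. -/
theorem exists_irreducible_of_realisation {VA VB : Type} [AddCommGroup VA] [Module ℂ VA] [FiniteDimensional ℂ VA]
    [AddCommGroup VB] [Module ℂ VB] [FiniteDimensional ℂ VB] (ρA : Representation ℂ (G q) VA) (ρB : Representation ℂ (G q) VB)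
    (hAB : ∀ g, (cubicNewvectorChar q g : ℂ) = ρA.character g - ρB.character g)
    (hnorm : ∑ g : G q, cubicNewvectorChar q g ^ 2 = Fintype.card (G q)) :
    ∃ (U : Type) (_ : AddCommGroup U) (_ : Module ℂ U) (_ : FiniteDimensional ℂ U) (ρU : Representation ℂ (G q) U),
      ρU.IsIrreducible ∧ ∀ g, ρU.character g = (cubicNewvectorChar q g : ℂ) := by
  set f : G q → ℂ := fun g => (cubicNewvectorChar q g : ℂ) with hfdef
  have hf : ∀ g, f g = ρA.character g - ρB.character g := hAB
  have hfinv : ∀ g, f g⁻¹ = f g := fun g => by simp only [hfdef, char_inv]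
  have hnormk : ∑ g, f g * f g⁻¹ = Fintype.card (G q) := by
    have := congrArg (fun z : ℤ => (z : ℂ)) hnorm
    push_cast at this
    rw [← this]
    exact Finset.sum_congr rfl (fun g _ => by rw [hfinv, sq])
  have hdim : Module.finrank ℂ VB < Module.finrank ℂ VA := by
    have h1 := hf 1
    rw [Representation.char_one, Representation.char_one, hfdef] at h1
    have h1' : ((cubicNewvectorChar q 1 : ℤ) : ℂ) = ((Module.finrank ℂ VA : ℤ) - (Module.finrank ℂ VB : ℤ) : ℤ) := by
      push_cast; exact h1
    have h2 := Int.cast_injective (α := ℂ) h1'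
    have h3 := char_one_pos (q := q)
    omega
  obtain ⟨U, _, _, _, ρU, hirr, -, hχU⟩ := exists_irreducible_of_virtual_normOne ρA ρB f hf hnormk hdim
  exact ⟨U, _, _, ‹_›, ρU, hirr, hχU⟩

/-- for `q ∉ {2, 3}` the tree supplies the realisation (`psChar_eq` ∕ `cuspChar_eq`) and the norm (`CartanSupply.NormOne.sum_sq_eq_card`). -/
theorem exists_irreducible_cubic (hq2 : q ≠ 2) (hq3 : q ≠ 3) :
    ∃ (U : Type) (_ : AddCommGroup U) (_ : Module ℂ U) (_ : FiniteDimensional ℂ U) (ρU : Representation ℂ (G q) U),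
      ρU.IsIrreducible ∧ ∀ g, ρU.character g = (cubicNewvectorChar q g : ℂ) := by
  obtain ⟨ζ, hζ⟩ := exists_primitiveRoot_three_units
  rcases CartanSupply.prime_mod_three (Fact.out : q.Prime) hq3 with h1 | h2
  · exact exists_irreducible_of_realisation (monRep (borelSub q) (borelChar hζ h1)) (1 : Representation ℂ (G q) (Fin 0 → ℂ))
      (fun g => by rw [character_one_fin_zero, sub_zero, psChar_eq hζ h1 g]) (CartanSupply.NormOne.sum_sq_eq_card hq3 hq2)
  · have hq5 : 5 ≤ q := by have := (Fact.out : q.Prime).two_le; omega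
    obtain ⟨eta, hη⟩ := CartanSupply.exists_not_hasRatEigenvalue (q := q) hq2
    obtain ⟨ψ, hψ⟩ := exists_addChar_ne_one q
    exact exists_irreducible_of_realisation (monRep (znSub q) (znChar ψ)) (monRep (torusSubgroup eta) (torusChar hζ hη hq5))
      (fun g => cuspChar_eq hζ hq2 h2 hq5 hη hψ g) (CartanSupply.NormOne.sum_sq_eq_card hq3 hq2)

end Realisation

/-! ### §F.5 (FGT-PS) PROVED: the cubic Borel eigenvector pins the principal series -/

section PS

open Representation (IntertwiningMap)
open Summit.BirchSwinnertonDyer.BirchSwinnertonDyer.Theorems.CartanTorusCubeCut (G Mat)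
open Summit.BirchSwinnertonDyer.BirchSwinnertonDyer.Theorems.CartanSupply.Monomial

variable {q : ℕ} [Fact q.Prime]

/-- a cubic Borel character agrees on `B` with the tree's `borelChar` for a suitable primitive cube root `ζ` (the value at a generator). -/
theorem lam_eq_borelChar (h1 : q % 3 = 1) {lam : GL (Fin 2) (ZMod q) → ℂ} (hlam : IsCubicBorelCharacter q lam) :
    ∃ (ζ : ℂˣ) (hζ : IsPrimitiveRoot ζ 3), ∀ b : borelSub q, lam b = borelChar hζ h1 b := by
  obtain ⟨hmul, hcube, t, ht01, ht10, ht1⟩ := hlam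
  have hdiagB : ∀ c : (ZMod q)ˣ, ((diagU c : GL (Fin 2) (ZMod q)) : Matrix (Fin 2) (Fin 2) (ZMod q)) 1 0 = 0 := fun c => by
    simp [coe_diagU]
  have hB1 : lam 1 = 1 := hcube 1 (by simp) ⟨1, one_ne_zero, by simp⟩
  have hpow : ∀ (c : (ZMod q)ˣ) (n : ℕ), lam (diagU (c ^ n)) = lam (diagU c) ^ n := by
    intro c n
    induction n with
    | zero => rw [pow_zero, pow_zero, diagU_one, hB1]
    | succ n ih => rw [pow_succ, ← diagU_mul, hmul _ _ (hdiagB _) (hdiagB _), ih, pow_succ]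
  set g₀ : (ZMod q)ˣ := gen (inferInstance : IsCyclic (ZMod q)ˣ) with hg₀
  have hgen : ∀ c : (ZMod q)ˣ, ∃ n : ℕ, g₀ ^ n = c := fun c =>
    (mem_powers_iff_mem_zpowers (G := (ZMod q)ˣ)).2 (gen_spec _ c)
  set z : ℂ := lam (diagU g₀) with hz
  have hz3 : z ^ 3 = 1 := by
    rw [hz, ← hpow]
    refine hcube _ (hdiagB _) ⟨(g₀ : ZMod q), g₀.ne_zero, ?_⟩
    simp [coe_diagU, Units.val_pow_eq_pow_val]
  have hz1 : z ≠ 1 := by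
    intro hz1
    apply ht1
    obtain ⟨c, -, hc10, hc00⟩ := diag_decomp t ht01 ht10
    have hsc : lam ((diagU c)⁻¹ * t) = 1 := hcube _ hc10 ⟨1, one_ne_zero, by rw [one_pow, one_mul, hc00]⟩
    obtain ⟨n, hn⟩ := hgen c
    calc lam t = lam (diagU c * ((diagU c)⁻¹ * t)) := by rw [mul_inv_cancel_left]
      _ = lam (diagU c) * lam ((diagU c)⁻¹ * t) := hmul _ _ (hdiagB c) hc10
      _ = 1 := by rw [hsc, mul_one, ← hn, hpow, ← hz, hz1, one_pow]
  have hprim : IsPrimitiveRoot z 3 := by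
    refine IsPrimitiveRoot.mk_of_lt z (by norm_num) hz3 fun l hl0 hl3 => ?_
    interval_cases l
    · rwa [pow_one]
    · intro h2
      apply hz1
      calc z = z * z ^ 2 := by rw [h2, mul_one]
        _ = z ^ 3 := by ring
        _ = 1 := hz3
  have hu : IsUnit z := hprim.isUnit (by norm_num)
  have hζ : IsPrimitiveRoot hu.unit 3 := IsPrimitiveRoot.coe_units_iff.1 (by rw [IsUnit.unit_spec]; exact hprim)
  refine ⟨hu.unit, hζ, fun b => ?_⟩
  have hdr : diagRatio ⟨diagU (diagRatio b), hdiagB _⟩ = diagRatio b := by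
    have e : (⟨diagU (diagRatio b), hdiagB _⟩ : borelSub q) = ⟨upperGL (diagRatio b) 1 0, upperGL_mem _ 1 0⟩ :=
      Subtype.ext (Units.ext (by simp [coe_diagU, upperGL_coe]))
    rw [e, diagRatio_upperGL, inv_one, mul_one]
  -- `x := (diagU r)⁻¹ · b` has diagonal ratio one, so `lam x = 1`
  have hxB : (((diagU (diagRatio b))⁻¹ * (b : GL (Fin 2) (ZMod q)) : GL (Fin 2) (ZMod q)) : Matrix (Fin 2) (Fin 2) (ZMod q)) 1 0 = 0 :=
    (borelSub q).mul_mem ((borelSub q).inv_mem (hdiagB _)) b.2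
  have hx1 : diagRatio ⟨(diagU (diagRatio b))⁻¹ * (b : GL (Fin 2) (ZMod q)), hxB⟩ = 1 := by
    have e : (⟨(diagU (diagRatio b))⁻¹ * (b : GL (Fin 2) (ZMod q)), hxB⟩ : borelSub q) = ⟨diagU (diagRatio b), hdiagB _⟩⁻¹ * b := rfl
    rw [e, map_mul, map_inv, hdr, inv_mul_cancel]
  set X : Matrix (Fin 2) (Fin 2) (ZMod q) :=
    (((diagU (diagRatio b))⁻¹ * (b : GL (Fin 2) (ZMod q)) : GL (Fin 2) (ZMod q)) : Matrix (Fin 2) (Fin 2) (ZMod q)) with hX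
  have hxeq : X 0 0 = X 1 1 := by
    have h : X 0 0 * (X 1 1)⁻¹ = 1 := by
      have := congrArg (fun u : (ZMod q)ˣ => (u : ZMod q)) hx1
      rw [diagRatio_val, Units.val_one] at this
      exact this
    have h11 : X 1 1 ≠ 0 := (CartanSupply.CubicPoints.diag_ne_zero_of_upper _ hxB).2
    calc X 0 0 = X 0 0 * (X 1 1)⁻¹ * X 1 1 := by rw [mul_assoc, inv_mul_cancel₀ h11, mul_one]
      _ = X 1 1 := by rw [h, one_mul]
  have hlamx : lam ((diagU (diagRatio b))⁻¹ * (b : GL (Fin 2) (ZMod q))) = 1 :=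
    hcube _ hxB ⟨1, one_ne_zero, by rw [one_pow, one_mul]; exact hxeq⟩
  obtain ⟨n, hn⟩ := hgen (diagRatio b)
  have hlb : lam b = z ^ n := by
    calc lam b = lam (diagU (diagRatio b) * ((diagU (diagRatio b))⁻¹ * (b : GL (Fin 2) (ZMod q)))) := by rw [mul_inv_cancel_left]
      _ = lam (diagU (diagRatio b)) * lam ((diagU (diagRatio b))⁻¹ * (b : GL (Fin 2) (ZMod q))) := hmul _ _ (hdiagB _) hxB
      _ = z ^ n := by rw [hlamx, mul_one, ← hn, hpow]
  have hbc : borelChar hζ h1 b = ((hu.unit ^ n : ℂˣ) : ℂ) := by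
    rw [borelChar_apply, ← hn, map_pow, show unitCubicChar hζ h1 g₀ = hu.unit from cubicChar_gen _ hζ _]
  rw [hlb, hbc, Units.val_pow_eq_pow_val, IsUnit.unit_spec]

/-- **(FGT-PS) PROVED.** -/
theorem cubicPrincipalSeriesCharacter : CubicPrincipalSeriesCharacter := by
  intro q _ h1 W _ _ _ ρ hirr lam v hv0 hlam heig
  have hq2 : q ≠ 2 := by rintro rfl; norm_num at h1
  have hq3 : q ≠ 3 := by rintro rfl; norm_num at h1
  obtain ⟨ζ, hζ, hlamB⟩ := lam_eq_borelChar h1 hlam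
  obtain ⟨U, _, _, _, ρU, hUirr, hχU⟩ := exists_irreducible_cubic hq2 hq3
  have hvB : ∀ b : borelSub q, res ρ (borelSub q) b v = borelChar hζ h1 b • v := fun b => by
    rw [res_apply, ← hlamB b]; exact heig b b.2
  have hpos := finrank_hom_pos (borelChar hζ h1) (res ρ (borelSub q)) hv0 hvB
  have hpair : ∑ g : G q, ρ.character g * ρU.character g⁻¹ ≠ 0 := by
    have hrw : ∀ g : G q, ρU.character g⁻¹ = (monRep (borelSub q) (borelChar hζ h1)).character g⁻¹ := fun g => by
      rw [hχU, psChar_eq hζ h1]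
    simp_rw [hrw]
    rw [frobenius_reciprocity]
    exact mul_ne_zero (by exact_mod_cast Fintype.card_ne_zero) (by exact_mod_cast hpos.ne')
  intro g
  rw [← hχU g]
  exact char_eq_of_pairing_ne_zero ρU ρ hUirr hirr hpair g

end PS

end Summit.BirchSwinnertonDyer.BirchSwinnertonDyer.Theorems.CartanDoubleCoset

end
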